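import Summits.NavierStokesRegularity.NavierStokesRegularity.Theorems.SymmetricLiouville.Negative.FinerCuts
import Literature.Analysis.FluidPDE.TypeIAncientMild
import Literature.Analysis.FluidPDE.KNSSAxisymmetricNoSwirlHolds
import Literature.Analysis.FluidPDE.SelfSimilarLiouvilleSwirlDecayProofs
import Literature.Analysis.FluidPDE.LeiZhangZhao2017LiouvilleSwirlLp

/-!
# Disproof of `AxisymEndLiouville` — findings

Standing adversary file (cdisprove, D-0016) for crux `stmt-NavierStokesRegularity-14061`
(`Summit.NavierStokesRegularity.NavierStokesRegularity.Theses.SymmetryModuliCount.AxisymEndLiouville`,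
route `SymmetryModuliCount`, rank 4): *if `u ∈ 𝒜_C` (`IsTypeIAncientMild C u`: smooth on
`(−∞,0) × ℝ³`, divergence free, KNSS/Oseen-mild between all pairs of times `s < t < 0`, Type-I in
time `‖u(t,x)‖ ≤ C/√(−t)`) is annihilated on a backward end `t < θ ≤ 0` by the rotation field of a
nonzero skew `A` about the axis through `c` (`Du·A(x−c) − Au = 0`), then `u ≡ 0` on that end.*

VERDICT OF CYCLE 1: **no kill.** The statement is faithful (no junk route) and is a sub-case of
the KNSS Liouville conjecture (swirl case, Type-I in time) that is OPEN IN PRINT; every hypothesis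
of the class is load-bearing (kernel-checked); FOUR printed leaves (no swirl / `|u| ≤ C/r` /
swirl → 0 at radial infinity / swirl in `L^∞_t L^p_x`) are PROVED below for vertical axes from tree
theorems, and on vertical axes the crux is EQUIVALENT to each of the corresponding a-priori
statements (`verticalAxes_iff_decay`, `vertical_iff_swirlFades`, `vertical_iff_swirlLp`); a NEW
a-priori estimate is claimed with a barrier proof (§(e), `SwirlBoundClaim`: `|Γ| ≤ 2C²` for every
axisymmetric element — the swirl of the class is BOUNDED). So a counterexample must be a genuine
smooth ancient Navier–Stokes solution, axisymmetric WITH swirl, Type-I in time, with bounded swirl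
`0 < sup|Γ| ≤ 2C²` approached only at radial infinity (LRZ 2019 §4) and not fading there, and with
`sup_x |x'||u(x,t)| = ∞` on every backward end carried by the POLOIDAL components — i.e. a
negative instance of the bounded-swirl axisymmetric Liouville problem (Zhang–Pan 2022 survey,
open) inside the Type-I-in-time class. No such object (indeed no nonzero Type-I ancient mild
solution at all) is known; §(c)–(d) record why none is expected and where the open content sits
(the parabolic far field `|x'|/√(−t) → ∞`, i.e. the vertex time off the axis).

The farm's build of the route module predates rev 5/7 of the route (the decl `AxisymEndLiouville`
is not yet served), so this file works on the verbatim local mirror `AxisymEndLiouvilleLocal`; the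
bridge `AxisymEndLiouville ↔ AxisymEndLiouvilleLocal` is `Iff.rfl` and will be appended when the
module is served (nothing below depends on it).

## Findings (index; details in the docstrings)

* (0) SANITY. `zero_satisfies_hypotheses` (`0 ∈ 𝒜_C` is `J`-symmetric: not vacuous),
  `axisymEndLiouvilleLocal_of_neg` (`C < 0`: empty class, trivially true),
  `axisymEndLiouvilleLocal_of_typeIAncientLiouvilleMild` + `typeIAncientLiouvilleMild_iff`
  (`X = TypeIAncientLiouville ⇒` crux: the crux is weaker than the target, on the critical path).
* (a) LOAD-BEARING HYPOTHESES (each a named mutant `AxisymEndLiouville…` + a kernel-checked `¬`):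
  - `axisymEndLiouville_false_without_typeI` — drop Type-I decay: FALSE, constant `e_z` (constants
    are in the gauge class; `J e_z = 0` makes axial constants symmetric about EVERY vertical axis);
  - `axisymEndLiouville_false_bounded` — decay replaced by boundedness: FALSE (same witness; a
    bounded-ancient axisymmetric Liouville theorem can only conclude `u = b e_z`, KNSS Thm 5.2);
  - `axisymEndLiouville_false_typeI_near_zero_bounded_past` — Type-I only on `(−1,0)` + bounded
    past: FALSE (same witness): it is the DECAY AT `−∞` that is used;
  - `axisymEndLiouville_false_without_mild` — drop the Oseen equation: FALSE, parasitic
    `(1−t)⁻¹ e_z` (Type-I with `C = 1`): the KNSS gauge is used; false in duality-form classes;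
  - `axisymEndLiouville_false_mild_on_window` — Oseen equation only inside a final window
    `(−T,0)`: FALSE for every `T > 0`, faded axial constant `φ_T(t) e_z`: the gauge must reach `−∞`,
    no proof can be localised to a final window;
  - `axisymEndLiouville_false_without_theta_nonpos` — drop `θ ≤ 0`: FALSE formally (the class does
    not see `t ≥ 0`; switched-on `ψ(t) e_z`), a statement-hygiene fact only;
  - `axisymEndLiouvilleWithoutANeZero_iff` — drop `A ≠ 0`: the mutant IS `X` (`↔`), so the rotation
    is everything that separates the leaf from the trunk.
* (b) WHERE A COUNTEREXAMPLE MUST LIVE (vertical axes `A = αJ`, `α ≠ 0`, any centre `c`; the class is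
  translation covariant, `isTypeIAncientMild_comp_add`; a tilted axis is one fixed rotation of `ℝ³`
  away — rotation covariance of the heat/Oseen kernels, bookkeeping not formalised here):
  - `isAxisymmetric_of_fderiv_rotGen` — infinitesimal ⇒ integrated axisymmetry (new bridge, the
    converse of the tree's `IsAxisymmetric.fderiv_rotGen`);
  - `vertical_noSwirl_end`, `verticalAxis_noSwirl_end` — crux hypotheses + NO SWIRL ⇒ `u ≡ 0` on
    the end: PROVED (time shift into the bounded class, KNSS Thm 5.2 = tree
    `knss_axisymmetric_no_swirl_holds`, gauge kills axial constants). A counterexample has swirl.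
  - `vertical_rBound_end`, `verticalAxis_rBound_end` — crux hypotheses + KNSS's bound
    `dist(x,axis)‖u‖ ≤ C'` on the end ⇒ `u ≡ 0`: PROVED (KNSS Thm 5.3 = tree
    `knss_bound_C_over_r_holds`). A counterexample has `sup |x'||u| = ∞` on every end.
  - `vertical_swirlDecay_end` — + swirl `Γ → 0` at radial infinity uniformly in `t` ⇒ `u ≡ 0`:
    PROVED (Lei–Zhang–Zhao 2017 Rem 1.4 = tree `leiZhangZhao2017_liouville_swirl_decay_holds`).
  - `vertical_swirlLp_end` — + `sup_t ‖Γ(t)‖_{L^p} < ∞` for some `1 ≤ p < ∞` ⇒ `u ≡ 0`: PROVED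
    (LZZ 2017 Thm 1.3 = tree `leiZhangZhao2017_liouville_swirl_Lp_holds`); `abs_swirl_le_typeI`
    (`|Γ| ≤ C r/√(−t)`) squeezes the persisting swirl into the parabolic far field `r ≳ √(−t)`.
  - `vertical_iff_axisDecay`, `verticalAxes_iff_decay` — **the crux on vertical axes ⇔
    `VerticalAxesDecay`** (every such element obeys `dist(x,axis)‖u(t,x)‖ ≤ C'(u)` on the end):
    the open content is an ESTIMATE, the first line of KNSS's proof of Thm 6.2 ("it is enough to
    prove that `f = |x'||u|` is bounded", arXiv:0709.3599 p. 12), there obtained from far-field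
    decay of Cauchy data which `𝒜_C` lacks; `vertical_of_local`, `verticalAxes_of_local`;
    likewise `vertical_iff_swirlFades`, `vertical_iff_swirlLp` (the web of equivalent a-priori
    statements) and `UniformFarFieldSmallness` with `uniformFarFieldSmallness_of_vertical`.
* (e) `SwirlBoundClaim` (`|Γ| ≤ 2C²`, barrier proof in its docstring, NOT formalised: needs a
  global comparison principle for `∂_t + b·∇ + (2/r)∂_r − Δ` with linear growth) and its
  kernel-checked consequence through the tree `swirl_sup_at_infinity_of_claim` (LRZ 2019 §4).
* (c)–(d) WHY IT RESISTS, what was tried, and the disprover's map of the open content: prose block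
  at the end. `-- Targets`: none (no line picked, `stuck_stubs = []`).
-/

noncomputable section

set_option linter.dupNamespace false

namespace Summit.NavierStokesRegularity.NavierStokesRegularity.Cruxes.AxisymEndLiouville.Disproof

open Literature.Analysis.FluidPDE Literature.Analysis.UnboundedOperators MeasureTheory Set Function Filter
open scoped RealInnerProductSpace Topology

open Summit.NavierStokesRegularity.NavierStokesRegularity.Theorems.SymmetricLiouville.Negative
  (ez norm_ez ez_ne_zero isDivFree_fun_const const_mild fade fade_eq_one fade_eq_zero fade_mem_Icc)

/-- `ℝ³` as in the route file. -/
abbrev E3 : Type := EuclideanSpace ℝ (Fin 3)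

/-! ## The crux, local verbatim mirror -/

/-- Local verbatim copy of the route decl `SymmetryModuliCount.AxisymEndLiouville`
(stmt-NavierStokesRegularity-14061); `axisymEndLiouville_iff_local : AxisymEndLiouville ↔ this` is
`Iff.rfl` (stated at the end of the file once the farm serves the rev-7 route module). -/
def AxisymEndLiouvilleLocal : Prop :=
  ∀ (C : ℝ) (u : ℝ → E3 → E3), IsTypeIAncientMild C u →
    ∀ (c : E3) (A : E3 →L[ℝ] E3) (θ : ℝ), (∀ x, ⟪A x, x⟫ = 0) → A ≠ 0 → θ ≤ 0 →
      (∀ t < θ, ∀ x, fderiv ℝ (u t) x (A (x - c)) - A (u t x) = 0) → ∀ t < θ, ∀ x, u t x = 0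

/-! ## The rotation generator about the `z`-axis and axial constant fields -/

/-- The generator `J = rotGenL` (`J x = (−x₁, x₀, 0)`) is skew, in the crux's sense. -/
theorem rotGenL_skew : ∀ x : E3, ⟪rotGenL x, x⟫ = 0 := fun x => by
  rw [rotGenL_apply]; exact inner_rotGen_self x

/-- `J ≠ 0` (`J e₀ = e₁`). -/
theorem rotGenL_ne_zero : (rotGenL : E3 →L[ℝ] E3) ≠ 0 := by
  intro h
  have h1 : rotGenL (EuclideanSpace.single 0 (1 : ℝ)) = 0 := by rw [h]; rfl
  rw [rotGenL_apply, rotGen_single_zero] at h1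
  have h2 := congrArg (fun v : E3 => v 1) h1
  simp at h2

/-- `J e_z = 0`: the axial unit vector `ez = e_z` of the sibling file is killed by the generator. -/
theorem rotGen_ez : rotGen ez = 0 := rotGen_single_two

/-- **Axial (time-dependent) constants are axisymmetric about every vertical axis**: for
`u(t, x) = b(t) • e_z` the symmetry clause of the crux holds with `A = J`, any centre `c`, at
every time. -/
theorem axial_symm (b : ℝ → ℝ) (c : E3) (t : ℝ) (x : E3) :
    fderiv ℝ ((fun (t : ℝ) (_ : E3) => b t • ez) t) x (rotGenL (x - c)) -
      rotGenL ((fun (t : ℝ) (_ : E3) => b t • ez) t x) = 0 := by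
  simp [rotGen_ez]

/-- The constant field `e_z` satisfies the symmetry clause with `A = J`, any centre, any time. -/
theorem const_ez_symm (c : E3) (t : ℝ) (x : E3) :
    fderiv ℝ ((fun (_ : ℝ) (_ : E3) => ez) t) x (rotGenL (x - c)) -
      rotGenL ((fun (_ : ℝ) (_ : E3) => ez) t x) = 0 := by
  simp [rotGen_ez]

/-- The constant field `e_z` does not vanish on any end `t < θ`. -/
theorem const_ez_not_vanish (θ : ℝ) : ¬ ∀ t < θ, ∀ x : E3, (fun (_ : ℝ) (_ : E3) => ez) t x = 0 :=
  fun h => ez_ne_zero (h (θ - 1) (by linarith) 0)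

/-! ## (a) Load-bearing hypotheses -/

/-- The crux with the Type-I decay clause of `IsTypeIAncientMild` DROPPED (smooth, divergence
free, KNSS/Oseen-mild between all `s < t < 0`; symmetry hypotheses verbatim). -/
def AxisymEndLiouvilleWithoutTypeI : Prop :=
  ∀ (u : ℝ → E3 → E3), ContDiffOn ℝ (⊤ : ℕ∞) (uncurry u) (Iio 0 ×ˢ univ) →
    (∀ t < 0, VectorCalculus.IsDivFree (u t)) →
    (∀ s t : ℝ, s < t → t < 0 → ∀ x, u t x = heatFlow (u s) (t - s) x -
      ∫ τ in Ioo s t, ∫ y, oseenKernel (t - τ) (x - y) (u τ y) (u τ y)) →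
    ∀ (c : E3) (A : E3 →L[ℝ] E3) (θ : ℝ), (∀ x, ⟪A x, x⟫ = 0) → A ≠ 0 → θ ≤ 0 →
      (∀ t < θ, ∀ x, fderiv ℝ (u t) x (A (x - c)) - A (u t x) = 0) → ∀ t < θ, ∀ x, u t x = 0

/-- **Type-I decay is load-bearing.** Without it the crux is FALSE: the constant axial field
`u ≡ e_z` is smooth, divergence free, KNSS-mild (constants ARE in the gauge class: `e^{σΔ}c = c`,
`∫K(σ,x−y)[c,c]dy = 0`, KNSS 2009 Rem. 6.1) and axisymmetric WITH RESPECT TO EVERY VERTICAL AXIS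
(`J e_z = 0`), yet nonzero. Any proof must use the decay `‖u(t)‖_∞ → 0` as `t → −∞`. -/
theorem axisymEndLiouville_false_without_typeI : ¬ AxisymEndLiouvilleWithoutTypeI := fun h =>
  const_ez_not_vanish 0 (h (fun _ _ => ez) contDiffOn_const (fun _ _ => isDivFree_fun_const ez)
    (fun _ _ hst _ x => const_mild ez hst x) 0 rotGenL 0 rotGenL_skew rotGenL_ne_zero le_rfl
    (fun t _ x => const_ez_symm 0 t x))


/-- The crux with Type-I decay REPLACED by boundedness of the whole past. -/
def AxisymEndLiouvilleBounded : Prop :=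
  ∀ (u : ℝ → E3 → E3), ContDiffOn ℝ (⊤ : ℕ∞) (uncurry u) (Iio 0 ×ˢ univ) →
    (∀ t < 0, VectorCalculus.IsDivFree (u t)) →
    (∀ s t : ℝ, s < t → t < 0 → ∀ x, u t x = heatFlow (u s) (t - s) x -
      ∫ τ in Ioo s t, ∫ y, oseenKernel (t - τ) (x - y) (u τ y) (u τ y)) →
    (∃ M : ℝ, ∀ t < 0, ∀ x, ‖u t x‖ ≤ M) →
    ∀ (c : E3) (A : E3 →L[ℝ] E3) (θ : ℝ), (∀ x, ⟪A x, x⟫ = 0) → A ≠ 0 → θ ≤ 0 →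
      (∀ t < θ, ∀ x, fderiv ℝ (u t) x (A (x - c)) - A (u t x) = 0) → ∀ t < θ, ∀ x, u t x = 0

/-- **Boundedness does not replace the decay**: the bounded-ancient version of the crux is FALSE
(constant field `e_z` again). An axisymmetric Liouville theorem for BOUNDED ancient mild solutions
can at best conclude `u ≡ b e_z` (KNSS 2009 Thm 5.2's conclusion `(0, 0, b₃)`), never `u ≡ 0`. -/
theorem axisymEndLiouville_false_bounded : ¬ AxisymEndLiouvilleBounded := fun h =>
  const_ez_not_vanish 0 (h (fun _ _ => ez) contDiffOn_const (fun _ _ => isDivFree_fun_const ez)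
    (fun _ _ hst _ x => const_mild ez hst x) ⟨1, fun _ _ _ => by simp [norm_ez]⟩ 0 rotGenL 0
    rotGenL_skew rotGenL_ne_zero le_rfl (fun t _ x => const_ez_symm 0 t x))

/-- The crux with Type-I decay assumed only on the final window `(−1, 0)` plus BOUNDEDNESS of the
whole past (all other clauses verbatim). -/
def AxisymEndLiouvilleTypeINearZeroBoundedPast : Prop :=
  ∀ (C : ℝ) (u : ℝ → E3 → E3), ContDiffOn ℝ (⊤ : ℕ∞) (uncurry u) (Iio 0 ×ˢ univ) →
    (∀ t < 0, VectorCalculus.IsDivFree (u t)) →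
    (∀ s t : ℝ, s < t → t < 0 → ∀ x, u t x = heatFlow (u s) (t - s) x -
      ∫ τ in Ioo s t, ∫ y, oseenKernel (t - τ) (x - y) (u τ y) (u τ y)) →
    (∀ t ∈ Ioo (-1 : ℝ) 0, ∀ x, ‖u t x‖ ≤ C / Real.sqrt (-t)) → (∀ t < 0, ∀ x, ‖u t x‖ ≤ C) →
    ∀ (c : E3) (A : E3 →L[ℝ] E3) (θ : ℝ), (∀ x, ⟪A x, x⟫ = 0) → A ≠ 0 → θ ≤ 0 →
      (∀ t < θ, ∀ x, fderiv ℝ (u t) x (A (x - c)) - A (u t x) = 0) → ∀ t < θ, ∀ x, u t x = 0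

/-- **It is the decay at `t = −∞` that is used**, not the rate near `t = 0`: Type-I on `(−1, 0)`
plus a bounded past does not suffice (constant field `e_z`, `1 ≤ 1/√(−t)` on `(−1, 0)`). -/
theorem axisymEndLiouville_false_typeI_near_zero_bounded_past :
    ¬ AxisymEndLiouvilleTypeINearZeroBoundedPast := by
  intro h
  refine const_ez_not_vanish 0 (h 1 (fun _ _ => ez) contDiffOn_const
    (fun _ _ => isDivFree_fun_const ez) (fun _ _ hst _ x => const_mild ez hst x) ?_
    (fun t _ x => by simp [norm_ez]) 0 rotGenL 0 rotGenL_skew rotGenL_ne_zero le_rfl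
    (fun t _ x => const_ez_symm 0 t x))
  rintro t ⟨ht1, ht2⟩ x
  have hs : 0 < Real.sqrt (-t) := Real.sqrt_pos.2 (by linarith)
  have hs1 : Real.sqrt (-t) ≤ 1 := by
    rw [Real.sqrt_le_left zero_le_one]
    linarith
  rw [le_div_iff₀ hs]
  calc ‖(fun (_ : ℝ) (_ : E3) => ez) t x‖ * Real.sqrt (-t) = 1 * Real.sqrt (-t) := by
        simp [norm_ez]
    _ ≤ 1 * 1 := by gcongr
    _ = 1 := one_mul _

/-! ### The gauge (Oseen integral equation) is load-bearing -/

/-- The crux with the KNSS/Oseen integral equation DROPPED (smooth, divergence free, Type-I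
decay on all of `t < 0`; symmetry hypotheses verbatim). -/
def AxisymEndLiouvilleWithoutMild : Prop :=
  ∀ (C : ℝ) (u : ℝ → E3 → E3), ContDiffOn ℝ (⊤ : ℕ∞) (uncurry u) (Iio 0 ×ˢ univ) →
    (∀ t < 0, VectorCalculus.IsDivFree (u t)) → HasTypeITimeDecay C u →
    ∀ (c : E3) (A : E3 →L[ℝ] E3) (θ : ℝ), (∀ x, ⟪A x, x⟫ = 0) → A ≠ 0 → θ ≤ 0 →
      (∀ t < θ, ∀ x, fderiv ℝ (u t) x (A (x - c)) - A (u t x) = 0) → ∀ t < θ, ∀ x, u t x = 0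

/-- The parasitic axial field `u(t, x) = (1 − t)⁻¹ • e_z` (KNSS 2009 §1: the solutions `b(t)`,
`∇p = −b'(t)·x` which the mild formulation removes). -/
def parasiticAxial : ℝ → E3 → E3 := fun t _ => (1 - t)⁻¹ • ez

/-- The parasitic axial field is smooth on `t < 0` (indeed on `t < 1`). -/
theorem parasiticAxial_smooth : ContDiffOn ℝ (⊤ : ℕ∞) (uncurry parasiticAxial) (Iio 0 ×ˢ univ) := by
  unfold parasiticAxial
  have h1 : ContDiffOn ℝ (⊤ : ℕ∞) (fun p : ℝ × E3 => (1 - p.1)⁻¹) (Iio 0 ×ˢ univ) := by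
    refine ContDiffOn.inv (contDiffOn_const.sub contDiff_fst.contDiffOn) ?_
    rintro ⟨t, x⟩ ⟨ht, -⟩
    simp only [mem_Iio] at ht
    exact ne_of_gt (by linarith)
  exact h1.smul contDiffOn_const

/-- `√(−t) ≤ 1 − t` for `t < 0` (AM–GM). -/
theorem sqrt_neg_le_one_sub' {t : ℝ} (ht : t < 0) : Real.sqrt (-t) ≤ 1 - t := by
  rw [Real.sqrt_le_left (by linarith)]
  nlinarith [sq_nonneg (t + 1)]

/-- The parasitic axial field is Type-I with constant `1`: `(1 − t)⁻¹ ≤ 1/√(−t)`. -/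
theorem parasiticAxial_typeI : HasTypeITimeDecay 1 parasiticAxial := by
  intro t ht x
  have hs : 0 < Real.sqrt (-t) := Real.sqrt_pos.2 (by linarith)
  have h1t : 0 < 1 - t := by linarith
  simp only [parasiticAxial, norm_smul, norm_inv, Real.norm_eq_abs, abs_of_pos h1t, norm_ez,
    mul_one]
  rw [inv_eq_one_div]
  exact div_le_div_of_nonneg_left zero_le_one hs (sqrt_neg_le_one_sub' ht)

/-- **The KNSS gauge is load-bearing.** Without the Oseen integral equation the crux is FALSE:
the parasitic axial field `(1 − t)⁻¹ e_z` is smooth, divergence free, Type-I with `C = 1` and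
axisymmetric about every vertical axis, yet `u(−1) = ½ e_z ≠ 0`. Any proof must use the gauge; in
particular the statement is false verbatim in duality-form ("very weak") ancient classes, which do
not see `x`-independent fields (cf. `Literature…isBoundedAncientMildSolution_timeConst`). -/
theorem axisymEndLiouville_false_without_mild : ¬ AxisymEndLiouvilleWithoutMild := by
  intro h
  have key := h 1 parasiticAxial parasiticAxial_smooth
    (fun t _ => isDivFree_fun_const ((1 - t)⁻¹ • ez)) parasiticAxial_typeI 0 rotGenL 0
    rotGenL_skew rotGenL_ne_zero le_rfl (fun t _ x => axial_symm (fun t => (1 - t)⁻¹) 0 t x)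
    (-1) (by norm_num) 0
  have h1 : ((1 : ℝ) - (-1))⁻¹ • ez = 0 := key
  rw [smul_eq_zero] at h1
  rcases h1 with h1 | h1
  · norm_num at h1
  · exact ez_ne_zero h1

/-- The crux with the Oseen integral equation assumed only between times of a final window
`(−T, 0)` (smoothness, divergence, Type-I decay on ALL `t < 0`, symmetry hypotheses verbatim). -/
def AxisymEndLiouvilleMildOnWindow (T : ℝ) : Prop :=
  ∀ (C : ℝ) (u : ℝ → E3 → E3), ContDiffOn ℝ (⊤ : ℕ∞) (uncurry u) (Iio 0 ×ˢ univ) →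
    (∀ t < 0, VectorCalculus.IsDivFree (u t)) →
    (∀ s t : ℝ, -T < s → s < t → t < 0 → ∀ x, u t x = heatFlow (u s) (t - s) x -
      ∫ τ in Ioo s t, ∫ y, oseenKernel (t - τ) (x - y) (u τ y) (u τ y)) →
    HasTypeITimeDecay C u →
    ∀ (c : E3) (A : E3 →L[ℝ] E3) (θ : ℝ), (∀ x, ⟪A x, x⟫ = 0) → A ≠ 0 → θ ≤ 0 →
      (∀ t < θ, ∀ x, fderiv ℝ (u t) x (A (x - c)) - A (u t x) = 0) → ∀ t < θ, ∀ x, u t x = 0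

/-- The **faded axial constant** `u(t, x) = φ_T(t) • e_z` (`φ_T = fade T` of the sibling file:
`1` on `[−T, ∞)`, `0` on `(−∞, −2T]`, values in `[0, 1]`). -/
def fadedAxial (T : ℝ) : ℝ → E3 → E3 := fun t _ => fade T t • ez

/-- The faded axial constant is jointly smooth. -/
theorem fadedAxial_contDiff (T : ℝ) : ContDiff ℝ (⊤ : ℕ∞) (uncurry (fadedAxial T)) := by
  have h : ContDiff ℝ (⊤ : ℕ∞) (fun p : ℝ × E3 => fade T p.1) :=
    Real.smoothTransition.contDiff.comp ((contDiff_fst.div_const T).add contDiff_const)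
  exact h.smul contDiff_const

/-- **The gauge must reach back to `t = −∞`.** With the Oseen equation only on a final window
`(−T, 0)` the crux is FALSE for every `T > 0`: the faded axial constant `φ_T(t) e_z` is smooth,
divergence free, Type-I on ALL of `t < 0` with `C = √(2T)`, axisymmetric about every vertical
axis, satisfies the Oseen equation between any two times of the window (where it is the constant
`e_z`), yet `u(−T/2) = e_z ≠ 0`. (It is not in `𝒜_C`: between `s < −2T` and `t > −T` the equation
fails.) So "ancient" is used through the gauge clause AT ALL PAIRS OF TIMES, and a proof of the
crux cannot be localised to a final window. -/
theorem axisymEndLiouville_false_mild_on_window {T : ℝ} (hT : 0 < T) :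
    ¬ AxisymEndLiouvilleMildOnWindow T := by
  intro h
  have hval : ∀ t, -T ≤ t → ∀ x : E3, fadedAxial T t x = ez := fun t ht x => by
    simp [fadedAxial, fade_eq_one hT ht]
  have key := h (Real.sqrt (2 * T)) (fadedAxial T) (fadedAxial_contDiff T).contDiffOn
    (fun t _ => isDivFree_fun_const _) ?_ ?_ 0 rotGenL 0 rotGenL_skew rotGenL_ne_zero le_rfl
    (fun t _ x => axial_symm (fade T) 0 t x) (-T / 2) (by linarith) 0
  · rw [hval (-T / 2) (by linarith)] at key
    exact ez_ne_zero key
  · -- the Oseen equation on the window, where the field is the constant `e_z`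
    intro s t hs hst _ x
    have hus : fadedAxial T s = fun _ : E3 => ez := funext (hval s hs.le)
    rw [hval t (by linarith) x, hus]
    have hD : ∫ τ in Ioo s t, ∫ y, oseenKernel (t - τ) (x - y) (fadedAxial T τ y)
        (fadedAxial T τ y) = ∫ τ in Ioo s t, ∫ y, oseenKernel (t - τ) (x - y) ez ez := by
      refine setIntegral_congr_fun measurableSet_Ioo fun τ hτ => ?_
      have hτ' : -T ≤ τ := by linarith [hτ.1]
      simp only [hval τ hτ']
    rw [hD]
    exact const_mild ez hst x
  · -- Type-I on all of `t < 0` with `C = √(2T)`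
    intro t ht x
    have hst : 0 < Real.sqrt (-t) := Real.sqrt_pos.2 (by linarith)
    rcases le_or_gt t (-(2 * T)) with h2 | h2
    · have : fadedAxial T t x = 0 := by simp [fadedAxial, fade_eq_zero hT h2]
      rw [this, norm_zero]
      positivity
    · have hle : Real.sqrt (-t) ≤ Real.sqrt (2 * T) := Real.sqrt_le_sqrt (by linarith)
      rw [le_div_iff₀ hst]
      have hn : ‖fadedAxial T t x‖ ≤ 1 := by
        simp only [fadedAxial, norm_smul, norm_ez, mul_one, Real.norm_eq_abs,
          abs_of_nonneg (fade_mem_Icc T t).1]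
        exact (fade_mem_Icc T t).2
      calc ‖fadedAxial T t x‖ * Real.sqrt (-t) ≤ 1 * Real.sqrt (2 * T) := by gcongr
        _ = Real.sqrt (2 * T) := one_mul _

/-! ### The formal side conditions `θ ≤ 0` and `A ≠ 0` -/

/-- `IsTypeIAncientMild` only sees `t < 0`: two fields that agree at negative times are in the
class together (every clause — smoothness on the open slab, divergence, the Oseen equation
between `s < t < 0`, whose Duhamel term integrates over `τ ∈ (s, t)`, and the decay — evaluates `u`
at negative times only). -/
theorem isTypeIAncientMild_congr_neg {C : ℝ} {u v : ℝ → E3 → E3} (huv : ∀ t < 0, u t = v t)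
    (hv : IsTypeIAncientMild C v) : IsTypeIAncientMild C u := by
  refine ⟨?_, fun t ht => ?_, fun s t hst ht x => ?_, fun t ht x => ?_⟩
  · refine hv.contDiffOn.congr ?_
    rintro ⟨t, x⟩ ⟨ht, -⟩
    simp only [uncurry_apply_pair, huv t ht]
  · rw [huv t ht]; exact hv.isDivFree ht
  · have hs : s < 0 := hst.trans ht
    have hD : oseenDuhamel 1 s u u t x = oseenDuhamel 1 s v v t x := by
      rw [oseenDuhamel_apply, oseenDuhamel_apply]
      refine setIntegral_congr_fun measurableSet_Ioo fun τ hτ => ?_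
      simp only [huv τ (hτ.2.trans ht)]
    rw [huv t ht, huv s hs, hD]
    exact hv.mild_eq hst ht x
  · rw [huv t ht]; exact hv.norm_le ht x

/-- The crux with the side condition `θ ≤ 0` DROPPED. -/
def AxisymEndLiouvilleWithoutThetaNonpos : Prop :=
  ∀ (C : ℝ) (u : ℝ → E3 → E3), IsTypeIAncientMild C u →
    ∀ (c : E3) (A : E3 →L[ℝ] E3) (θ : ℝ), (∀ x, ⟪A x, x⟫ = 0) → A ≠ 0 →
      (∀ t < θ, ∀ x, fderiv ℝ (u t) x (A (x - c)) - A (u t x) = 0) → ∀ t < θ, ∀ x, u t x = 0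

/-- The field `ψ(t) • e_z` with `ψ = Real.smoothTransition` (`0` for `t ≤ 0`, positive after). -/
def switchedOnAxial : ℝ → E3 → E3 := fun t _ => Real.smoothTransition t • ez

/-- `switchedOnAxial` vanishes at negative times. -/
theorem switchedOnAxial_neg (t : ℝ) (ht : t < 0) : switchedOnAxial t = fun _ => (0 : E3) := by
  funext x
  simp [switchedOnAxial, Real.smoothTransition.zero_of_nonpos ht.le]

/-- Hence it is in the class `𝒜_C` for every `C ≥ 0` (it agrees with `0` at negative times). -/
theorem switchedOnAxial_mem {C : ℝ} (hC : 0 ≤ C) : IsTypeIAncientMild C switchedOnAxial :=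
  isTypeIAncientMild_congr_neg (fun t ht => by rw [switchedOnAxial_neg t ht]; rfl)
    (isTypeIAncientMild_zero hC)

/-- **`θ ≤ 0` is load-bearing — as a formalisation matter.** The class `IsTypeIAncientMild` does
not constrain `u` at `t ≥ 0`, so with `θ > 0` allowed the switched-on axial constant
`ψ(t) e_z` (zero for `t ≤ 0`) is in `𝒜_C`, axisymmetric about every vertical axis at ALL times,
and nonzero at `t = 1/2 < θ = 1`. (Not a mathematical phenomenon: it only records that the item's
`θ ≤ 0` cannot be deleted in the Lean statement.) -/
theorem axisymEndLiouville_false_without_theta_nonpos : ¬ AxisymEndLiouvilleWithoutThetaNonpos := by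
  intro h
  have key := h 0 switchedOnAxial (switchedOnAxial_mem le_rfl) 0 rotGenL 1 rotGenL_skew
    rotGenL_ne_zero (fun t _ x => axial_symm Real.smoothTransition 0 t x) (1 / 2) (by norm_num) 0
  have hpos : 0 < Real.smoothTransition (1 / 2 : ℝ) := Real.smoothTransition.pos_of_pos (by norm_num)
  have h1 : Real.smoothTransition (1 / 2 : ℝ) • ez = 0 := key
  rw [smul_eq_zero] at h1
  rcases h1 with h1 | h1
  · exact hpos.ne' h1
  · exact ez_ne_zero h1

/-- The crux with `A ≠ 0` DROPPED. -/
def AxisymEndLiouvilleWithoutANeZero : Prop :=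
  ∀ (C : ℝ) (u : ℝ → E3 → E3), IsTypeIAncientMild C u →
    ∀ (c : E3) (A : E3 →L[ℝ] E3) (θ : ℝ), (∀ x, ⟪A x, x⟫ = 0) → θ ≤ 0 →
      (∀ t < θ, ∀ x, fderiv ℝ (u t) x (A (x - c)) - A (u t x) = 0) → ∀ t < θ, ∀ x, u t x = 0

/-- The route's target `X = TypeIAncientLiouville` over the bundled class: every Type-I ancient
mild field vanishes (`↔ TypeIAncientLiouville` by `isTypeIAncientMild_iff`, below). -/
def TypeIAncientLiouvilleMild : Prop :=
  ∀ (C : ℝ) (u : ℝ → E3 → E3), IsTypeIAncientMild C u → ∀ t < 0, ∀ x, u t x = 0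

/-- **`A ≠ 0` is load-bearing up to the whole trunk**: with `A = 0` admitted the symmetry clause
is vacuous (`Du·0 − 0 = 0`) and the mutant IS the route's target `X` (over `𝒜_C`, on ends). So the
crux is a genuine LEAF of `X`: everything that distinguishes it from `X` is the rotation. -/
theorem axisymEndLiouvilleWithoutANeZero_iff : AxisymEndLiouvilleWithoutANeZero ↔ TypeIAncientLiouvilleMild := by
  constructor
  · intro h C u hu t ht x
    exact h C u hu 0 0 0 (fun x => by simp) le_rfl (fun t _ x => by simp) t ht x
  · intro h C u hu c A θ _ hθ _ t ht x
    exact h C u hu t (lt_of_lt_of_le ht hθ) x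

/-- The bundled target is the route's `TypeIAncientLiouville` (definitional bridge
`isTypeIAncientMild_iff`). -/
theorem typeIAncientLiouvilleMild_iff :
    TypeIAncientLiouvilleMild ↔
      Summit.NavierStokesRegularity.NavierStokesRegularity.Theses.SymmetryModuliCount.TypeIAncientLiouville := by
  constructor
  · intro h C u hu
    exact h C u (isTypeIAncientMild_iff.2 hu)
  · intro h C u hu
    exact h C u (isTypeIAncientMild_iff.1 hu)

/-- **The crux is weaker than the target**: `X` implies it (so a kill of the crux kills `X` and
the route — the crux is on the critical path, not a side bet). -/
theorem axisymEndLiouvilleLocal_of_typeIAncientLiouvilleMild :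
    TypeIAncientLiouvilleMild → AxisymEndLiouvilleLocal :=
  fun h C u hu _ _ _ _ _ hθ _ t ht x => h C u hu t (lt_of_lt_of_le ht hθ) x

/-! ### (0) Sanity: the hypotheses are satisfiable, the trivial regimes -/

/-- For `C < 0` the class is empty (`IsTypeIAncientMild.nonneg`), so the crux holds trivially
there. -/
theorem axisymEndLiouvilleLocal_of_neg (C : ℝ) (hC : C < 0) (u : ℝ → E3 → E3)
    (hu : IsTypeIAncientMild C u) : ∀ t < (0 : ℝ), ∀ x, u t x = 0 :=
  absurd hu.nonneg (not_le.2 hC)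

/-- Non-vacuity: the zero field satisfies every hypothesis of the crux (with `A = J`, any centre),
so the crux is not true for lack of instances. -/
theorem zero_satisfies_hypotheses {C : ℝ} (hC : 0 ≤ C) (c : E3) :
    IsTypeIAncientMild C (0 : ℝ → E3 → E3) ∧ (∀ x : E3, ⟪rotGenL x, x⟫ = 0) ∧ rotGenL ≠ 0 ∧
      ∀ t < (0 : ℝ), ∀ x : E3, fderiv ℝ ((0 : ℝ → E3 → E3) t) x (rotGenL (x - c)) -
        rotGenL ((0 : ℝ → E3 → E3) t x) = 0 :=
  ⟨isTypeIAncientMild_zero hC, rotGenL_skew, rotGenL_ne_zero, fun t _ x => by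
    simpa using (map_zero rotGenL)⟩


/-! ## (b) Where a counterexample must live: the two printed leaves, PROVED for the vertical axis

A counterexample to the crux is an element of `𝒜_C` annihilated by a rotation field. Up to a rigid
motion (covariance of the Oseen class, not formalised here) the axis is the vertical axis through
the origin and `A = J = rotGenL` (a nonzero multiple changes nothing). For that axis the tree's
PROVED renderings of KNSS 2009 Thm 5.2 (`knss_axisymmetric_no_swirl_holds`) and Thm 5.3
(`knss_bound_C_over_r_holds`), composed with the bridges `isBoundedAncientMildSolution_sub` (time
shift into the bounded class), `eq_zero_of_slice_const` (the gauge kills axial constants) and the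
infinitesimal ⇒ integrated symmetry lemma below, kill every candidate that is swirl-free OR obeys
KNSS's bound `r‖u‖ ≤ C'`. -/

/-- `R_{−θ} v` through the generator: `R_{−θ} v = −cos θ • J(Jv) − sin θ • Jv + (v + J(Jv))`
(`J(Jv) = −v_h`, `v + J(Jv) = v_z e_z`). -/
theorem rotZ_neg_eq (θ : ℝ) (v : E3) :
    rotZ (-θ) v =
      (-Real.cos θ) • rotGen (rotGen v) - Real.sin θ • rotGen v + (v + rotGen (rotGen v)) := by
  ext i
  fin_cases i <;> (simp [rotZ, rotGen, Real.cos_neg, Real.sin_neg]; try ring)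

/-- The orbit `θ ↦ R_θ x` has velocity `J (R_θ x)`. -/
theorem hasDerivAt_rotZ_rotGen (x : E3) (θ : ℝ) :
    HasDerivAt (fun θ => rotZ θ x) (rotGen (rotZ θ x)) θ := by
  refine (hasDerivAt_rotZ x θ).congr_deriv ?_
  ext i
  fin_cases i <;> (simp [rotZ, rotGen]; try ring)

/-- **Infinitesimal ⇒ integrated axisymmetry** (the converse of the tree's
`IsAxisymmetric.fderiv_rotGen`): a differentiable field with `Df(x)[Jx] = J f(x)` everywhere is
equivariant under all rotations about the vertical axis. Proof: `g(θ) = R_{−θ} f(R_θ x)` has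
`g' ≡ 0` (`J³ = −J`), so `g(θ) = g(0) = f(x)`. -/
theorem isAxisymmetric_of_fderiv_rotGen {f : E3 → E3} (hf : Differentiable ℝ f)
    (h : ∀ x, fderiv ℝ f x (rotGen x) = rotGen (f x)) : IsAxisymmetric f := by
  intro θ x
  set F : ℝ → E3 := fun s => f (rotZ s x) with hF
  have hF' : ∀ s, HasDerivAt F (rotGen (F s)) s := fun s => by
    have h1 := (hf (rotZ s x)).hasFDerivAt.comp_hasDerivAt s (hasDerivAt_rotZ_rotGen x s)
    rw [h (rotZ s x)] at h1
    exact h1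
  have hJF : ∀ s, HasDerivAt (fun s => rotGenL (F s)) (rotGenL (rotGen (F s))) s :=
    fun s => rotGenL.hasFDerivAt.comp_hasDerivAt s (hF' s)
  have hJJF : ∀ s, HasDerivAt (fun s => rotGenL (rotGenL (F s)))
      (rotGenL (rotGenL (rotGen (F s)))) s :=
    fun s => rotGenL.hasFDerivAt.comp_hasDerivAt s (hJF s)
  set g : ℝ → E3 := fun s => rotZ (-s) (F s) with hg
  have hg_eq : g = fun s => (-Real.cos s) • rotGenL (rotGenL (F s)) -
      Real.sin s • rotGenL (F s) + (F s + rotGenL (rotGenL (F s))) := by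
    funext s
    simp only [hg, rotGenL_apply]
    exact rotZ_neg_eq s (F s)
  have hg' : ∀ s, HasDerivAt g 0 s := by
    intro s
    have h4 := (((Real.hasDerivAt_cos s).fun_neg.fun_smul (hJJF s)).fun_sub
      ((Real.hasDerivAt_sin s).fun_smul (hJF s))).fun_add ((hF' s).fun_add (hJJF s))
    rw [hg_eq]
    refine h4.congr_deriv ?_
    simp only [rotGenL_apply]
    ext i
    fin_cases i <;> (simp [rotGen]; try ring)
  have hconst : g θ = g 0 :=
    is_const_of_deriv_eq_zero (fun s => (hg' s).differentiableAt) (fun s => (hg' s).deriv) θ 0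
  have hg0 : g 0 = f x := by simp [hg, hF]
  calc f (rotZ θ x) = rotZ θ (rotZ (-θ) (f (rotZ θ x))) := by
        rw [← rotZ_add, add_neg_cancel, rotZ_zero]
    _ = rotZ θ (g θ) := rfl
    _ = rotZ θ (f x) := by rw [hconst, hg0]

/-- The crux's symmetry clause for the vertical axis (`A = J`, `c = 0`) makes every slice of an
element of `𝒜_C` axisymmetric in the integrated sense `u(t, R_θ x) = R_θ u(t, x)`. -/
theorem isAxisymmetric_slice_of_symm {C : ℝ} {u : ℝ → E3 → E3} (hu : IsTypeIAncientMild C u)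
    (hsym : ∀ t < 0, ∀ x, fderiv ℝ (u t) x (rotGenL (x - 0)) - rotGenL (u t x) = 0)
    {t : ℝ} (ht : t < 0) : IsAxisymmetric (u t) := by
  refine isAxisymmetric_of_fderiv_rotGen ((hu.contDiff_slice ht).differentiable (by simp)) ?_
  intro x
  have h := hsym t ht x
  rw [sub_zero, rotGenL_apply, rotGenL_apply] at h
  exact sub_eq_zero.1 h

/-- From an a.e.-constant continuous slice to a pointwise constant one. -/
theorem slice_eq_const_of_ae {C : ℝ} {u : ℝ → E3 → E3} (hu : IsTypeIAncientMild C u) {s : ℝ}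
    (hs : s < 0) {b : E3} (hb : u s =ᵐ[volume] fun _ => b) : ∀ x, u s x = b := fun x =>
  congrFun (((hu.continuous_slice hs).ae_eq_iff_eq volume continuous_const).1 hb) x

/-- **The swirl-free leaf, PROVED (vertical axis, whole past).** An element of `𝒜_C` which is
axisymmetric about the vertical axis in the crux's sense and has no swirl vanishes identically:
after a time shift it is a bounded ancient mild solution (`isBoundedAncientMildSolution_sub`),
KNSS 2009 Thm 5.2 (`knss_axisymmetric_no_swirl_holds`, proved in the tree) makes every slice the
axial constant `β(t) e_z`, and the gauge kills axial constants (`eq_zero_of_slice_const`). So a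
counterexample to the crux MUST HAVE SWIRL. -/
theorem vertical_noSwirl_past {C : ℝ} {u : ℝ → E3 → E3} (hu : IsTypeIAncientMild C u)
    (hsym : ∀ t < 0, ∀ x, fderiv ℝ (u t) x (rotGenL (x - 0)) - rotGenL (u t x) = 0)
    (hsw : ∀ t < 0, HasNoSwirl (u t)) : ∀ t < 0, ∀ x, u t x = 0 := by
  -- every slice is constant
  have hconst : ∀ s < 0, ∀ x, u s x = u s 0 := by
    intro s hs x
    have hδ : 0 < -s / 2 := by linarith
    have hv := hu.isBoundedAncientMildSolution_sub hδ
    have hv' := hu.comp_sub_right hδ.le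
    obtain ⟨β, hβ⟩ := knss_axisymmetric_no_swirl_holds hv
      (fun t ht => hv'.aestronglyMeasurable_slice ht)
      (fun t ht => isAxisymmetric_slice_of_symm hu hsym (by linarith))
      (fun t ht => hsw _ (by linarith)) (s / 2) (by linarith)
    have e : s / 2 - -s / 2 = s := by ring
    rw [e] at hβ
    rw [slice_eq_const_of_ae hu hs hβ x, slice_eq_const_of_ae hu hs hβ 0]
  intro t ht x
  exact hu.eq_zero_of_slice_const (b := fun s => u s 0) hconst ht x

/-- **The `C/r` leaf, PROVED (vertical axis, whole past).** An element of `𝒜_C` which is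
axisymmetric about the vertical axis in the crux's sense and obeys KNSS's bound
`r ‖u(t, x)‖ ≤ C'` (`r = cylRadius x`, all `t < 0`) vanishes identically: time shift +
KNSS 2009 Thm 5.3 (`knss_bound_C_over_r_holds`, proved in the tree) + continuity. So a
counterexample to the crux MUST VIOLATE `sup r|u| < ∞` — on every backward end, by the end form
below. This is exactly the estimate `f = |x'||u| ∈ L^∞` of KNSS's proof of Thm 6.2 (arXiv p. 12),
which in print is obtained from far-field decay of the Cauchy data that `𝒜_C` does not have. -/
theorem vertical_rBound_past {C : ℝ} {u : ℝ → E3 → E3} (hu : IsTypeIAncientMild C u)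
    (hsym : ∀ t < 0, ∀ x, fderiv ℝ (u t) x (rotGenL (x - 0)) - rotGenL (u t x) = 0)
    (hb : ∃ C' : ℝ, ∀ t < 0, ∀ x, cylRadius x * ‖u t x‖ ≤ C') : ∀ t < 0, ∀ x, u t x = 0 := by
  obtain ⟨C', hC'⟩ := hb
  intro s hs x
  have hδ : 0 < -s / 2 := by linarith
  have hv := hu.isBoundedAncientMildSolution_sub hδ
  have hv' := hu.comp_sub_right hδ.le
  have h0 := knss_bound_C_over_r_holds hv (fun t ht => hv'.aestronglyMeasurable_slice ht)
    (fun t ht => isAxisymmetric_slice_of_symm hu hsym (by linarith))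
    ⟨C', fun t ht x => hC' _ (by linarith) x⟩ (s / 2) (by linarith)
  have e : s / 2 - -s / 2 = s := by ring
  rw [e] at h0
  have := slice_eq_const_of_ae hu hs (b := 0) h0 x
  simpa using this

/-- Reduction of an END statement (`t < θ`, `θ ≤ 0`) to the whole past by the admissible forward
re-indexing `v(t) = u(t + θ) = u(t − (−θ))` (`IsTypeIAncientMild.comp_sub_right`). -/
theorem end_of_past {C : ℝ} {u : ℝ → E3 → E3} (hu : IsTypeIAncientMild C u) {θ : ℝ} (hθ : θ ≤ 0)
    {P : (E3 → E3) → Prop}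
    (hpast : ∀ v : ℝ → E3 → E3, IsTypeIAncientMild C v → (∀ t < 0, P (v t)) → ∀ t < 0, ∀ x, v t x = 0)
    (hP : ∀ t < θ, P (u t)) : ∀ t < θ, ∀ x, u t x = 0 := by
  intro t ht x
  have hv := hu.comp_sub_right (neg_nonneg.2 hθ)
  have key := hpast (fun t => u (t - -θ)) hv (fun s hs => hP _ (by linarith)) (t - θ) (by linarith) x
  have e : t - θ - -θ = t := by ring
  rwa [e] at key

/-- **Swirl-free leaf on an end** (vertical axis): crux hypotheses with `A = J`, `c = 0`, plus
`HasNoSwirl` on the end ⇒ `u ≡ 0` on the end. -/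
theorem vertical_noSwirl_end {C : ℝ} {u : ℝ → E3 → E3} (hu : IsTypeIAncientMild C u) {θ : ℝ}
    (hθ : θ ≤ 0) (hsym : ∀ t < θ, ∀ x, fderiv ℝ (u t) x (rotGenL (x - 0)) - rotGenL (u t x) = 0)
    (hsw : ∀ t < θ, HasNoSwirl (u t)) : ∀ t < θ, ∀ x, u t x = 0 :=
  end_of_past hu hθ (P := fun f => (∀ x, fderiv ℝ f x (rotGenL (x - 0)) - rotGenL (f x) = 0) ∧
      HasNoSwirl f)
    (fun _ hv hPv => vertical_noSwirl_past hv (fun t ht => (hPv t ht).1) (fun t ht => (hPv t ht).2))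
    (fun t ht => ⟨hsym t ht, hsw t ht⟩)

/-- **`C/r` leaf on an end** (vertical axis): crux hypotheses with `A = J`, `c = 0`, plus KNSS's
bound `r‖u‖ ≤ C'` on the end ⇒ `u ≡ 0` on the end. -/
theorem vertical_rBound_end {C : ℝ} {u : ℝ → E3 → E3} (hu : IsTypeIAncientMild C u) {θ : ℝ}
    (hθ : θ ≤ 0) (hsym : ∀ t < θ, ∀ x, fderiv ℝ (u t) x (rotGenL (x - 0)) - rotGenL (u t x) = 0)
    {C' : ℝ} (hb : ∀ t < θ, ∀ x, cylRadius x * ‖u t x‖ ≤ C') : ∀ t < θ, ∀ x, u t x = 0 :=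
  end_of_past hu hθ (P := fun f => (∀ x, fderiv ℝ f x (rotGenL (x - 0)) - rotGenL (f x) = 0) ∧
      ∀ x, cylRadius x * ‖f x‖ ≤ C')
    (fun _ hv hPv => vertical_rBound_past hv (fun t ht => (hPv t ht).1)
      ⟨C', fun t ht => (hPv t ht).2⟩)
    (fun t ht => ⟨hsym t ht, hb t ht⟩)

/-! ### The crux on the vertical axis IS KNSS's a-priori estimate `f = r|u| ∈ L^∞` -/

/-- The crux specialised to the vertical axis through the origin (`A = J`, `c = 0`). -/
def AxisymEndLiouvilleVertical : Prop :=
  ∀ (C : ℝ) (u : ℝ → E3 → E3), IsTypeIAncientMild C u → ∀ θ : ℝ, θ ≤ 0 →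
    (∀ t < θ, ∀ x, fderiv ℝ (u t) x (rotGenL (x - 0)) - rotGenL (u t x) = 0) →
    ∀ t < θ, ∀ x, u t x = 0

/-- **KNSS's estimate for abstract ancient elements** (the statement printed as the first line of
the proof of KNSS 2009 Thm 6.2, "it is enough to prove that `f = |x'||u|` is bounded", there
derived from decay of the Cauchy data): every element of `𝒜_C` axisymmetric about the vertical
axis on an end obeys `r ‖u(t, x)‖ ≤ C'` on that end, for some `C' = C'(u)`. -/
def VerticalAxisDecay : Prop :=
  ∀ (C : ℝ) (u : ℝ → E3 → E3), IsTypeIAncientMild C u → ∀ θ : ℝ, θ ≤ 0 →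
    (∀ t < θ, ∀ x, fderiv ℝ (u t) x (rotGenL (x - 0)) - rotGenL (u t x) = 0) →
    ∃ C' : ℝ, ∀ t < θ, ∀ x, cylRadius x * ‖u t x‖ ≤ C'

/-- The crux implies its vertical-axis specialisation. -/
theorem vertical_of_local : AxisymEndLiouvilleLocal → AxisymEndLiouvilleVertical :=
  fun h C u hu θ hθ hsym => h C u hu 0 rotGenL θ rotGenL_skew rotGenL_ne_zero hθ hsym

/-- **REFORMULATION (kernel-checked): on the vertical axis the crux is EQUIVALENT to KNSS's
a-priori bound `sup r|u| < ∞`.** `→`: a vanishing field obeys any bound; `←`: the `C/r` leaf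
(`vertical_rBound_end`, i.e. KNSS Thm 5.3 proved in the tree). Hence the open content of the
crux is precisely an ESTIMATE — boundedness of the scale-invariant quantity `|x'| |u|` for
abstract Type-I ancient mild axisymmetric fields, with no far-field information — and a
counterexample is exactly an axisymmetric element of `𝒜_C` with `sup_x |x'||u(x,t)| = ∞` on every
end (with swirl, by `vertical_noSwirl_end`). -/
theorem vertical_iff_axisDecay : AxisymEndLiouvilleVertical ↔ VerticalAxisDecay := by
  constructor
  · intro h C u hu θ hθ hsym
    refine ⟨0, fun t ht x => ?_⟩
    rw [h C u hu θ hθ hsym t ht x, norm_zero, mul_zero]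
  · intro h C u hu θ hθ hsym
    obtain ⟨C', hC'⟩ := h C u hu θ hθ hsym
    exact vertical_rBound_end hu hθ hsym hC'


/-! ### Any vertical axis: space-translation covariance of the class, nonzero multiples of `J` -/

/-- Space-translation covariance of the caloric extension (inlined; cf. the tree's
`heatExtension_comp_add_right`). -/
theorem heatExtension_comp_add_right' (φ : E3 → E3) (a : E3) (τ : ℝ) (y : E3) :
    heatExtension (fun x => φ (x + a)) τ y = heatExtension φ τ (y + a) := by
  rw [heatExtension_apply, heatExtension_apply]
  congr 1
  funext z
  rw [sub_add_eq_add_sub]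

/-- Space-translation covariance of the Duhamel term (inlined; cf. the tree's
`oseenDuhamel_comp_add_right`). -/
theorem oseenDuhamel_comp_add_right' (ν s : ℝ) (u v : ℝ → E3 → E3) (a : E3) (t : ℝ) (x : E3) :
    oseenDuhamel ν s (fun τ y => u τ (y + a)) (fun τ y => v τ (y + a)) t x =
      oseenDuhamel ν s u v t (x + a) := by
  simp only [oseenDuhamel_apply]
  refine setIntegral_congr_fun measurableSet_Ioo fun τ _ => ?_
  rw [← integral_add_right_eq_self (fun y => oseenKernel (ν * (t - τ)) (x + a - y) (u τ y) (v τ y)) a]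
  refine integral_congr_ae (Eventually.of_forall fun y => ?_)
  simp only [add_sub_add_right_eq_sub]

/-- **The class `𝒜_C` is invariant under space translations** `u ↦ u(·, · + a)` (KNSS 2009, §1: the
symmetries of the problem; every clause commutes with translations). -/
theorem isTypeIAncientMild_comp_add {C : ℝ} {u : ℝ → E3 → E3} (hu : IsTypeIAncientMild C u)
    (a : E3) : IsTypeIAncientMild C (fun t x => u t (x + a)) := by
  refine ⟨?_, fun t ht => ?_, fun s t hst ht x => ?_, fun t ht x => hu.norm_le ht (x + a)⟩
  · have e : (uncurry fun t x => u t (x + a)) = uncurry u ∘ fun p : ℝ × E3 => (p.1, p.2 + a) := rfl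
    rw [e]
    refine hu.contDiffOn.comp
      ((contDiff_fst.prodMk (contDiff_snd.add contDiff_const)).contDiffOn) ?_
    rintro ⟨t, x⟩ ⟨ht, -⟩
    exact ⟨ht, mem_univ _⟩
  · intro x
    have hx := hu.isDivFree ht (x + a)
    simp only [VectorCalculus.divergence] at hx ⊢
    rw [fderiv_comp_add_right]
    exact hx
  · rw [heatFlow_of_pos _ (sub_pos.2 hst), heatExtension_comp_add_right', oseenDuhamel_comp_add_right',
      ← heatFlow_of_pos _ (sub_pos.2 hst)]
    exact hu.mild_eq hst ht (x + a)

/-- The symmetry clause about the vertical axis through `c`, for a nonzero multiple `α J` of the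
generator, transported to the translate `u(·, · + c)`: it becomes the clause about the axis through
the origin for `J` itself. -/
theorem symm_translate {u : ℝ → E3 → E3} {c : E3} {α : ℝ} (hα : α ≠ 0) {t : ℝ}
    (hsym : ∀ x, fderiv ℝ (u t) x ((α • rotGenL) (x - c)) - (α • rotGenL) (u t x) = 0) (x : E3) :
    fderiv ℝ ((fun t x => u t (x + c)) t) x (rotGenL (x - 0)) -
      rotGenL ((fun t x => u t (x + c)) t x) = 0 := by
  have h := hsym (x + c)
  simp only [FunLike.coe_smul, Pi.smul_apply, add_sub_cancel_right, map_smul,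
    ← smul_sub, smul_eq_zero] at h
  rcases h with h | h
  · exact absurd h hα
  · show fderiv ℝ (fun x => u t (x + c)) x (rotGenL (x - 0)) - rotGenL (u t (x + c)) = 0
    rw [fderiv_comp_add_right, sub_zero]
    exact h

/-- **Swirl-free leaf, any vertical axis.** Crux hypotheses with `A = α J` (`α ≠ 0`) about the
vertical axis through ANY centre `c`, plus no swirl about that axis on the end ⇒ `u ≡ 0` on the
end. -/
theorem verticalAxis_noSwirl_end {C : ℝ} {u : ℝ → E3 → E3} (hu : IsTypeIAncientMild C u) (c : E3)
    {α : ℝ} (hα : α ≠ 0) {θ : ℝ} (hθ : θ ≤ 0)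
    (hsym : ∀ t < θ, ∀ x, fderiv ℝ (u t) x ((α • rotGenL) (x - c)) - (α • rotGenL) (u t x) = 0)
    (hsw : ∀ t < θ, HasNoSwirl (fun x => u t (x + c))) : ∀ t < θ, ∀ x, u t x = 0 := by
  intro t ht x
  have hv := isTypeIAncientMild_comp_add hu c
  have key := vertical_noSwirl_end hv hθ
    (fun s hs y => symm_translate hα (hsym s hs) y) hsw t ht (x - c)
  simpa using key

/-- **`C/r` leaf, any vertical axis.** Crux hypotheses with `A = α J` (`α ≠ 0`) about the vertical
axis through ANY centre `c`, plus KNSS's bound `dist(x, axis) ‖u‖ ≤ C'` on the end ⇒ `u ≡ 0`. -/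
theorem verticalAxis_rBound_end {C : ℝ} {u : ℝ → E3 → E3} (hu : IsTypeIAncientMild C u) (c : E3)
    {α : ℝ} (hα : α ≠ 0) {θ : ℝ} (hθ : θ ≤ 0)
    (hsym : ∀ t < θ, ∀ x, fderiv ℝ (u t) x ((α • rotGenL) (x - c)) - (α • rotGenL) (u t x) = 0)
    {C' : ℝ} (hb : ∀ t < θ, ∀ x, cylRadius (x - c) * ‖u t x‖ ≤ C') : ∀ t < θ, ∀ x, u t x = 0 := by
  intro t ht x
  have hv := isTypeIAncientMild_comp_add hu c
  have key := vertical_rBound_end hv hθ (fun s hs y => symm_translate hα (hsym s hs) y)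
    (C' := C') (fun s hs y => by simpa using hb s hs (y + c)) t ht (x - c)
  simpa using key

/-- The crux restricted to VERTICAL axes (any centre `c`, any nonzero multiple `α J`). -/
def AxisymEndLiouvilleVerticalAxes : Prop :=
  ∀ (C : ℝ) (u : ℝ → E3 → E3), IsTypeIAncientMild C u → ∀ (c : E3) (α θ : ℝ), α ≠ 0 → θ ≤ 0 →
    (∀ t < θ, ∀ x, fderiv ℝ (u t) x ((α • rotGenL) (x - c)) - (α • rotGenL) (u t x) = 0) →
    ∀ t < θ, ∀ x, u t x = 0

/-- KNSS's estimate about VERTICAL axes: `dist(x, axis) ‖u(t,x)‖ ≤ C'(u)` on the end. -/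
def VerticalAxesDecay : Prop :=
  ∀ (C : ℝ) (u : ℝ → E3 → E3), IsTypeIAncientMild C u → ∀ (c : E3) (α θ : ℝ), α ≠ 0 → θ ≤ 0 →
    (∀ t < θ, ∀ x, fderiv ℝ (u t) x ((α • rotGenL) (x - c)) - (α • rotGenL) (u t x) = 0) →
    ∃ C' : ℝ, ∀ t < θ, ∀ x, cylRadius (x - c) * ‖u t x‖ ≤ C'

/-- `α • J` is skew. -/
theorem smul_rotGenL_skew (α : ℝ) : ∀ x : E3, ⟪(α • rotGenL) x, x⟫ = 0 := fun x => by
  simp [real_inner_smul_left, inner_rotGen_self]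

/-- `α • J ≠ 0` for `α ≠ 0`. -/
theorem smul_rotGenL_ne_zero {α : ℝ} (hα : α ≠ 0) : (α • rotGenL : E3 →L[ℝ] E3) ≠ 0 := by
  intro h
  exact rotGenL_ne_zero ((smul_eq_zero.1 h).resolve_left hα)

/-- The crux implies its vertical-axes restriction. -/
theorem verticalAxes_of_local : AxisymEndLiouvilleLocal → AxisymEndLiouvilleVerticalAxes :=
  fun h C u hu c α θ hα hθ hsym =>
    h C u hu c (α • rotGenL) θ (smul_rotGenL_skew α) (smul_rotGenL_ne_zero hα) hθ hsym

/-- **The crux on vertical axes ⇔ KNSS's estimate on vertical axes** (all centres, all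
rotation rates). The remaining gap to the verbatim crux is only the direction of the axis, i.e. the
conjugation of `𝒜_C` by a fixed rotation of `ℝ³` (rotation covariance of the heat and Oseen
kernels), which changes no analysis. -/
theorem verticalAxes_iff_decay : AxisymEndLiouvilleVerticalAxes ↔ VerticalAxesDecay := by
  constructor
  · intro h C u hu c α θ hα hθ hsym
    refine ⟨0, fun t ht x => ?_⟩
    rw [h C u hu c α θ hα hθ hsym t ht x, norm_zero, mul_zero]
  · intro h C u hu c α θ hα hθ hsym
    obtain ⟨C', hC'⟩ := h C u hu c α θ hα hθ hsym
    exact verticalAxis_rBound_end hu c hα hθ hsym hC'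


/-! ### Two further printed leaves (Lei–Zhang–Zhao 2017, in tree): the swirl must persist at radial infinity

Since `vertical_noSwirl_end`, a counterexample has swirl `Γ = r u_θ = swirl (u t)`. The tree's
PROVED renderings of Lei–Zhang–Zhao 2017 (arXiv:1701.00868) Remark 1.4
(`leiZhangZhao2017_liouville_swirl_decay_holds`: `Γ → 0` at radial infinity uniformly in `z, t` ⇒
`u = β(t) e_z`) and Theorem 1.3 (`leiZhangZhao2017_liouville_swirl_Lp_holds`:
`Γ ∈ L^∞_t L^p_x`, `1 ≤ p < ∞` ⇒ `u = β(t)e_z`) corner it further: ON EVERY BACKWARD END the swirl of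
a counterexample neither tends to zero at radial infinity uniformly in time nor stays bounded in
`L^p(ℝ³)` uniformly in time. Together with `|Γ| ≤ r‖u‖ ≤ C r/√(−t)` this places the obstruction in
the parabolic far field `r ≳ √(−t)`, `t ↑ θ`. -/

/-- If every backward shift of `u ∈ 𝒜_C` has a.e.-axial-constant slices, then `u ≡ 0` (continuity
makes the slices constant, the gauge kills axial constants: `eq_zero_of_slice_const`). The common
last step of the KNSS/LZZ-type leaves. -/
theorem eq_zero_of_shift_axialConst {C : ℝ} {u : ℝ → E3 → E3} (hu : IsTypeIAncientMild C u)
    (h : ∀ δ : ℝ, 0 < δ → ∀ t < 0, ∃ β : ℝ, (fun t => u (t - δ)) t =ᵐ[volume] fun _ => β • eZ) :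
    ∀ t < 0, ∀ x, u t x = 0 := by
  have hconst : ∀ s < 0, ∀ x, u s x = u s 0 := by
    intro s hs x
    obtain ⟨β, hβ⟩ := h (-s / 2) (by linarith) (s / 2) (by linarith)
    have e : s / 2 - -s / 2 = s := by ring
    simp only [e] at hβ
    rw [slice_eq_const_of_ae hu hs hβ x, slice_eq_const_of_ae hu hs hβ 0]
  intro t ht x
  exact hu.eq_zero_of_slice_const (b := fun s => u s 0) hconst ht x

/-- **Swirl-decay leaf, PROVED (vertical axis, whole past).** An element of `𝒜_C`, `J`-symmetric on
`t < 0`, whose swirl tends to zero at radial infinity uniformly in `t < 0` and `z`, vanishes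
(Lei–Zhang–Zhao 2017 Rem. 1.4 in tree, after the time shift; then the gauge). -/
theorem vertical_swirlDecay_past {C : ℝ} {u : ℝ → E3 → E3} (hu : IsTypeIAncientMild C u)
    (hsym : ∀ t < 0, ∀ x, fderiv ℝ (u t) x (rotGenL (x - 0)) - rotGenL (u t x) = 0)
    (hdec : ∀ ε : ℝ, 0 < ε → ∃ R : ℝ, ∀ t < 0, ∀ x, R ≤ cylRadius x → |swirl (u t) x| ≤ ε) :
    ∀ t < 0, ∀ x, u t x = 0 := by
  refine eq_zero_of_shift_axialConst hu fun δ hδ => ?_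
  have hv := hu.isBoundedAncientMildSolution_sub hδ
  have hv' := hu.comp_sub_right hδ.le
  refine leiZhangZhao2017_liouville_swirl_decay_holds _ hv
    (fun t ht => hv'.aestronglyMeasurable_slice ht)
    (fun t ht => isAxisymmetric_slice_of_symm hu hsym (by linarith)) fun ε hε => ?_
  obtain ⟨R, hR⟩ := hdec ε hε
  exact ⟨R, fun t ht x hx => hR (t - δ) (by linarith) x hx⟩

/-- **Swirl-`L^p` leaf, PROVED (vertical axis, whole past).** An element of `𝒜_C`, `J`-symmetric on
`t < 0`, whose swirl is bounded in `L^p(ℝ³)` (`1 ≤ p < ∞`) uniformly in `t < 0`, vanishes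
(Lei–Zhang–Zhao 2017 Thm. 1.3 in tree, after the time shift; then the gauge). -/
theorem vertical_swirlLp_past {C : ℝ} {u : ℝ → E3 → E3} (hu : IsTypeIAncientMild C u)
    (hsym : ∀ t < 0, ∀ x, fderiv ℝ (u t) x (rotGenL (x - 0)) - rotGenL (u t x) = 0)
    (hLp : ∃ (p : ENNReal) (K : NNReal), 1 ≤ p ∧ p < (⊤ : ENNReal) ∧
      ∀ t < 0, eLpNorm (swirl (u t)) p volume ≤ K) :
    ∀ t < 0, ∀ x, u t x = 0 := by
  refine eq_zero_of_shift_axialConst hu fun δ hδ => ?_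
  have hv := hu.isBoundedAncientMildSolution_sub hδ
  have hv' := hu.comp_sub_right hδ.le
  obtain ⟨p, K, hp1, hptop, hK⟩ := hLp
  exact leiZhangZhao2017_liouville_swirl_Lp_holds _ hv
    (fun t ht => hv'.aestronglyMeasurable_slice ht)
    (fun t ht => isAxisymmetric_slice_of_symm hu hsym (by linarith))
    ⟨p, K, hp1, hptop, fun t ht => hK (t - δ) (by linarith)⟩

/-- **Swirl-decay leaf on an end** (vertical axis). A counterexample to the crux has, on every
backward end, swirl that does NOT tend to zero at radial infinity uniformly in time. -/
theorem vertical_swirlDecay_end {C : ℝ} {u : ℝ → E3 → E3} (hu : IsTypeIAncientMild C u) {θ : ℝ}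
    (hθ : θ ≤ 0) (hsym : ∀ t < θ, ∀ x, fderiv ℝ (u t) x (rotGenL (x - 0)) - rotGenL (u t x) = 0)
    (hdec : ∀ ε : ℝ, 0 < ε → ∃ R : ℝ, ∀ t < θ, ∀ x, R ≤ cylRadius x → |swirl (u t) x| ≤ ε) :
    ∀ t < θ, ∀ x, u t x = 0 := by
  intro t ht x
  have hv := hu.comp_sub_right (neg_nonneg.2 hθ)
  have key := vertical_swirlDecay_past hv (fun s hs y => hsym _ (by linarith) y)
    (fun ε hε => ?_) (t - θ) (by linarith) x
  · have e : t - θ - -θ = t := by ring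
    rwa [e] at key
  · obtain ⟨R, hR⟩ := hdec ε hε
    exact ⟨R, fun s hs y hy => hR _ (by linarith) y hy⟩

/-- **Swirl-`L^p` leaf on an end** (vertical axis). A counterexample to the crux has, on every
backward end, `sup_t ‖Γ(t)‖_{L^p} = ∞` for every `1 ≤ p < ∞`. -/
theorem vertical_swirlLp_end {C : ℝ} {u : ℝ → E3 → E3} (hu : IsTypeIAncientMild C u) {θ : ℝ}
    (hθ : θ ≤ 0) (hsym : ∀ t < θ, ∀ x, fderiv ℝ (u t) x (rotGenL (x - 0)) - rotGenL (u t x) = 0)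
    (hLp : ∃ (p : ENNReal) (K : NNReal), 1 ≤ p ∧ p < (⊤ : ENNReal) ∧
      ∀ t < θ, eLpNorm (swirl (u t)) p volume ≤ K) :
    ∀ t < θ, ∀ x, u t x = 0 := by
  intro t ht x
  have hv := hu.comp_sub_right (neg_nonneg.2 hθ)
  obtain ⟨p, K, hp1, hptop, hK⟩ := hLp
  have key := vertical_swirlLp_past hv (fun s hs y => hsym _ (by linarith) y)
    ⟨p, K, hp1, hptop, fun s hs => hK _ (by linarith)⟩ (t - θ) (by linarith) x
  have e : t - θ - -θ = t := by ring
  rwa [e] at key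

/-- **The swirl of a counterexample is squeezed into the parabolic far field.** For `u ∈ 𝒜_C`,
`|Γ(t,x)| ≤ r ‖u(t,x)‖ ≤ C r/√(−t)`: the swirl is small wherever `r ≪ √(−t)`; so the non-decay of
`Γ` at radial infinity required by `vertical_swirlDecay_end` happens at times `t` with
`√(−t) ≲ r`, i.e. in the region `r/√(−t) ≳ 1` accumulating at the final time of the end. -/
theorem abs_swirl_le_typeI {C : ℝ} {u : ℝ → E3 → E3} (hu : IsTypeIAncientMild C u) {t : ℝ}
    (ht : t < 0) (x : E3) : |swirl (u t) x| ≤ cylRadius x * (C / Real.sqrt (-t)) :=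
  (abs_swirl_le_cylRadius_mul_norm (u t) x).trans
    (mul_le_mul_of_nonneg_left (hu.norm_le ht x) (cylRadius_nonneg x))


/-! ### The web of equivalent a-priori statements (vertical axis through the origin)

Because the crux makes the symmetric class `{0}`, every one of the leaves' extra hypotheses, read
as an a-priori property of ALL `J`-symmetric elements of `𝒜_C`, is EQUIVALENT to the crux on the
vertical axis. Kernel-checked: `vertical_iff_axisDecay` (KNSS's `sup |x'||u| < ∞`),
`vertical_iff_swirlFades` (LZZ's `Γ → 0` at radial infinity), `vertical_iff_swirlLp`
(`Γ ∈ L^∞_t L^p_x`). Recorded as a definition with the trivial direction proved: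
`UniformFarFieldSmallness` (`√(−t)|u| ≤ ε` beyond parabolic radius `R₀(ε)`, uniformly over the
class), whose converse direction is the entry-time Oseen bootstrap sketched in §(d) of the prose. -/

/-- A-priori statement: the swirl of every `J`-symmetric element of `𝒜_C` fades at radial infinity,
uniformly in time, on every end. -/
def VerticalSwirlFades : Prop :=
  ∀ (C : ℝ) (u : ℝ → E3 → E3), IsTypeIAncientMild C u → ∀ θ : ℝ, θ ≤ 0 →
    (∀ t < θ, ∀ x, fderiv ℝ (u t) x (rotGenL (x - 0)) - rotGenL (u t x) = 0) →
    ∀ ε : ℝ, 0 < ε → ∃ R : ℝ, ∀ t < θ, ∀ x, R ≤ cylRadius x → |swirl (u t) x| ≤ ε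

/-- A-priori statement: the swirl of every `J`-symmetric element of `𝒜_C` is bounded in some
`L^p(ℝ³)`, `1 ≤ p < ∞`, uniformly in time, on every end. -/
def VerticalSwirlLp : Prop :=
  ∀ (C : ℝ) (u : ℝ → E3 → E3), IsTypeIAncientMild C u → ∀ θ : ℝ, θ ≤ 0 →
    (∀ t < θ, ∀ x, fderiv ℝ (u t) x (rotGenL (x - 0)) - rotGenL (u t x) = 0) →
    ∃ (p : ENNReal) (K : NNReal), 1 ≤ p ∧ p < (⊤ : ENNReal) ∧
      ∀ t < θ, eLpNorm (swirl (u t)) p volume ≤ K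

/-- **Crux (vertical axis) ⇔ the swirl fades at radial infinity** (Lei–Zhang–Zhao Rem 1.4 leaf). -/
theorem vertical_iff_swirlFades : AxisymEndLiouvilleVertical ↔ VerticalSwirlFades := by
  constructor
  · intro h C u hu θ hθ hsym ε hε
    refine ⟨0, fun t ht x _ => ?_⟩
    have h0 : swirl (u t) x = 0 := by simp [swirl, h C u hu θ hθ hsym t ht x]
    rw [h0, abs_zero]
    exact hε.le
  · intro h C u hu θ hθ hsym
    exact vertical_swirlDecay_end hu hθ hsym (h C u hu θ hθ hsym)

/-- **Crux (vertical axis) ⇔ the swirl is `L^p`-bounded uniformly in time** (LZZ Thm 1.3 leaf). -/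
theorem vertical_iff_swirlLp : AxisymEndLiouvilleVertical ↔ VerticalSwirlLp := by
  constructor
  · intro h C u hu θ hθ hsym
    refine ⟨1, 0, le_rfl, ENNReal.one_lt_top, fun t ht => ?_⟩
    have h0 : swirl (u t) = 0 := by
      funext y
      simp only [swirl, h C u hu θ hθ hsym t ht y, Pi.zero_apply, PiLp.zero_apply, mul_zero,
        sub_zero]
    rw [h0, eLpNorm_zero]
    exact bot_le
  · intro h C u hu θ hθ hsym
    exact vertical_swirlLp_end hu hθ hsym (h C u hu θ hθ hsym)

/-- A-priori statement (input (3) of the entry-time bootstrap of §(d)): `√(−t)|u|` is uniformly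
small in the parabolic far field of the axis, uniformly over the `J`-symmetric elements of `𝒜_C`
(symmetric on the whole past): for every `ε > 0` there is `R₀` with `√(−t)‖u(t,x)‖ ≤ ε` whenever
`|x'| ≥ R₀√(−t)`. Expected from compactness of `𝒜_C` + the tree's `KNSS2009_typeI_rate_liouville_holds`
(recentring at far points turns the rotation into an `e₂`-translation); not formalised. -/
def UniformFarFieldSmallness : Prop :=
  ∀ C : ℝ, ∀ ε : ℝ, 0 < ε → ∃ R₀ : ℝ, ∀ (u : ℝ → E3 → E3), IsTypeIAncientMild C u →
    (∀ t < 0, ∀ x, fderiv ℝ (u t) x (rotGenL (x - 0)) - rotGenL (u t x) = 0) →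
    ∀ t < 0, ∀ x, R₀ * Real.sqrt (-t) ≤ cylRadius x → Real.sqrt (-t) * ‖u t x‖ ≤ ε

/-- The trivial direction: the crux (vertical axis) implies uniform far-field smallness (the class
is then `{0}`). The converse — modulo the entry-time Oseen bootstrap of §(d) — is the disprover's
proposed closing line; it is NOT proved here. -/
theorem uniformFarFieldSmallness_of_vertical : AxisymEndLiouvilleVertical → UniformFarFieldSmallness := by
  intro h C ε hε
  refine ⟨0, fun u hu hsym t ht x _ => ?_⟩
  rw [h C u hu 0 le_rfl hsym t ht x, norm_zero, mul_zero]
  exact hε.le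


/-! ### (e) A new a-priori estimate (CLAIM, barrier proof in the docstring): the swirl is bounded

Stated precisely and left UNPROVED here (the missing tool is a global comparison principle with a
linearly growing barrier for the swirl operator `∂_t + b·∇ + (2/r)∂_r − Δ`, which the tree does not
hold); its one formal consequence through the tree — Lei–Ren–Zhang's "the swirl supremum is
approached at radial infinity" — is kernel-checked modulo the claim. -/

/-- **CLAIM (SwirlBound).** Every element of `𝒜_C` that is `J`-symmetric on the whole past has
BOUNDED swirl: `|Γ(t,x)| = |x₀u₁ − x₁u₀| ≤ 2C²` for all `t < 0`, `x`.

Proof sketch (barrier; all inputs standard but the global comparison principle is not in the tree).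
`Γ = r u_θ` solves KNSS (1.9): `Γ_t + b·∇Γ + (2/r)Γ_r = ΔΓ`, `b = u_r e_r + u_z e_z`, `|b| ≤ C/√(−t)`.
Fix `T > 0`, `η > 0` and put `ψ(x,t) = (C/√T)·(ρ_η(x') + 2C(√T − √(−t)))`, `ρ_η = √(r² + η²)`. Then
(i) at `t = −T`: `|Γ| ≤ r‖u‖ ≤ (C/√T) r ≤ ψ`; (ii) `ψ` is a supersolution:
`ψ_t + b·∇ψ + (2/r)ψ_r − Δψ = (C/√T)[C/√(−t) + u_r r/ρ_η + 2/ρ_η − (r² + 2η²)/ρ_η³] ≥ 0`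
(`|u_r| ≤ C/√(−t)`, `(r²+2η²)/ρ_η³ ≤ 2/ρ_η`); (iii) `Γ − ψ` is smooth, axisymmetric, of linear
growth, so the comparison principle on `ℝ³ × [−T, t₀]` (penalise with `ε e^{λt}(|x|² + M)`,
`λ ≥ 1 + sup|b|²`; at an axial maximum `−Δw + (2/r)w_r = −w_zz ≥ 0`, the operator degenerates with the
right sign) gives `Γ ≤ ψ`; same for `−Γ`. Letting `T → ∞` at fixed `(x, t₀)`:
`|Γ(x,t₀)| ≤ lim (C/√T)ρ_η + 2C²(1 − √(−t₀)/√T) = 2C²`. ∎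
Scale check: `Γ` and `C` are dimensionless (`ν = 1`). The constant `2C²` is `∫_{−∞}^{0⁻}` of the
admissible inflow `C/√(−t)` against the Type-I growth `C/√T` of the data at `−T`: it is the Type-I
DECAY AT `−∞` (the load-bearing clause of §(a)) that bounds the swirl, with no far-field input.
Consequences: a counterexample to the crux is a bounded-swirl object (the standard setting of
Lei–Zhang 2011 / Lei–Ren–Zhang 2019 / Zhang–Pan 2022's axisymmetric Liouville problem, still open
in print), whose `sup |Γ| ∈ (0, 2C²]` is NOT attained at radial-finite points but approached at
radial infinity (`swirl_sup_at_infinity_of_claim`), and whose unbounded scale-invariant quantity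
`sup |x'||u| = ∞` (`verticalAxis_rBound_end`) comes from the POLOIDAL part `b`, not from `u_θ`
(`r|u_θ| = |Γ| ≤ 2C²`). -/
def SwirlBoundClaim : Prop :=
  ∀ (C : ℝ) (u : ℝ → E3 → E3), IsTypeIAncientMild C u →
    (∀ t < 0, ∀ x, fderiv ℝ (u t) x (rotGenL (x - 0)) - rotGenL (u t x) = 0) →
    ∀ t < 0, ∀ x, |swirl (u t) x| ≤ 2 * C ^ 2

/-- **Modulo the claim, Lei–Ren–Zhang 2019 §4 applies to every vertical-axis element of `𝒜_C`**
(tree `leiRenZhang2019_swirl_sup_at_infinity_holds`, after the time shift `δ > 0`): every level `ℓ`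
below the (essential) supremum of `|Γ|` on the shifted past is exceeded beyond every radius `R` at
some time — the swirl supremum of a would-be counterexample is approached at radial infinity. -/
theorem swirl_sup_at_infinity_of_claim (hSB : SwirlBoundClaim) {C : ℝ} {u : ℝ → E3 → E3}
    (hu : IsTypeIAncientMild C u)
    (hsym : ∀ t < 0, ∀ x, fderiv ℝ (u t) x (rotGenL (x - 0)) - rotGenL (u t x) = 0)
    {δ : ℝ} (hδ : 0 < δ) (ℓ R : ℝ)
    (hlevel : ∃ t₀ < 0, 0 < volume {x | ℓ < |swirl ((fun t => u (t - δ)) t₀) x|}) :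
    ∃ t < 0, 0 < volume {x | R ≤ cylRadius x ∧ ℓ < |swirl ((fun t => u (t - δ)) t) x|} := by
  have hv := hu.isBoundedAncientMildSolution_sub hδ
  have hv' := hu.comp_sub_right hδ.le
  exact leiRenZhang2019_swirl_sup_at_infinity_holds _ hv
    (fun t ht => hv'.aestronglyMeasurable_slice ht)
    (fun t ht => isAxisymmetric_slice_of_symm hu hsym (by linarith))
    ⟨2 * C ^ 2, fun t ht x => hSB C u hu hsym (t - δ) (by linarith) x⟩ ℓ R hlevel

/-- Sanity of the claim's SHAPE on the trivial element: `0` satisfies it. (The claim is consistent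
with the census: the potential-vortex tail `Γ_∞ e_θ/r`, the only stationary far field of the tail
count, has `Γ ≡ Γ_∞`, and Type-I at the parabolic boundary `r ∼ √(−t)` forces `C ≳ Γ_∞`, so
`Γ_∞ ≤ 2C²` is no contradiction for large `C`, while for `2C² < Γ_∞`-type small data the class is
perturbatively trivial anyway.) -/
theorem swirlBoundClaim_zero (C : ℝ) (t : ℝ) (x : E3) :
    |swirl ((0 : ℝ → E3 → E3) t) x| ≤ 2 * C ^ 2 := by
  simp [swirl]
  positivity


/-! ## (c) Why it resists; what was tried (prose record, cycle 1)

* NO JUNK ROUTE. For smooth `u` with `‖u(t,·)‖_∞ ≤ C/√(−t)` every clause of `𝒜_C` is honest (heat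
  flow = Gaussian convolution for `t − s > 0`; the Oseen double integral converges absolutely by
  Koch–Tataru (14)); `fderiv` acts on `C^∞` slices; the symmetry clause `Du·A(x−c) = Au` with
  `A ≠ 0` skew on `ℝ³` (spectrum `{0, ±iρ}`, one-dimensional kernel) is exactly infinitesimal
  equivariance under the rotations about the axis `c + ker A`, and integrates
  (`isAxisymmetric_of_fderiv_rotGen`) to `u(t, c + R(x−c)) = R u(t,x)`. So a counterexample is a
  GENUINE nonzero ancient mild Navier–Stokes solution, Type-I in time, axisymmetric with swirl —
  a negative instance of the KNSS Liouville conjecture (L) restricted to axisymmetric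
  Type-I-in-time fields (after the time shift `u(·−δ)` the field is a BOUNDED ancient mild
  solution, `isBoundedAncientMildSolution_sub`). None is known; (L) is believed.
* WHAT IS PROVED IN PRINT / IN THE TREE, and why it does not close the crux:
  KNSS 2009 Thm 5.2 (no swirl ⇒ `u = b(t)e_z`; tree, proved) closes the swirl-free sub-case HERE
  (`verticalAxis_noSwirl_end`, with the gauge). KNSS Thm 5.3 needs `|u| ≤ C/|x'|` (tree, proved;
  its core `KNSS2009_swirl_sup_nonpos` consumes the bound only as a UNIFORM `L^∞` bound on the
  rescaled drifts near the axis over the test window — see (d)) — HERE it turns the crux into the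
  estimate `VerticalAxesDecay` (`verticalAxes_iff_decay`). KNSS Thm 6.2 derives that estimate for
  blow-up limits from the decay of the Cauchy data at spatial infinity (tree fact
  `KNSS2009_typeI_rate_rMulNorm_bounded`, hypothesis "`|x'|‖u‖ ≤ C'` for `|x'| ≥ R₀`"), which an
  abstract element of `𝒜_C` does not have. Seregin–Šverák 2009 Thm 1.1/3.1 (tree
  `AxisymmetricTypeIExclusion_holds`) is LOCAL but lives in the suitable-weak/energy class up to
  the vertex — an element of `𝒜_C` has `∫_{B}|u(t)|² ≲ 1/(−t)` only, not the scaled-energy bounds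
  (`𝐈 < ∞`, Albritton–Barker 2019) that the local theory needs; that is the route's item
  FarPastLedger (#3), after which ε-regularity OFF the axis (axisymmetry spreads the energy of a
  ball of radius `ρ` at distance `r` over a torus, ratio `ρ/r`) yields exactly `|u| ≲ 1/|x'|` and
  Thm 5.3 applies. Lei–Zhang–Zhao 2017 Thm 1.3 / Rem 1.4 (tree, proved) need `Γ ∈ L^∞_t L^p_x`
  resp. `Γ → 0` at radial infinity — HERE they are the leaves `vertical_swirlLp_end` /
  `vertical_swirlDecay_end`; Lei–Ren–Zhang 2019 Thm 1.2 (tree, proved) needs a `1/r` RATE of `Γ²`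
  to its limit; Lei–Zhang 2011 needs a `BMO⁻¹` stream function; the z-PERIODIC case (LRZ Thm 1.1)
  is disjoint from `𝒜_C ∖ {0}` by the route's HelicalEndLiouville mechanism. The general
  bounded-swirl axisymmetric Liouville problem (Zhang–Pan, Anal. Theory Appl. 38 (2022), §3) is
  OPEN; by §(e) the crux is that problem intersected with the Type-I-in-time class.
* CANDIDATE FAMILIES CHECKED (all fail to be nonzero `J`-symmetric elements of `𝒜_C`): axial
  constants / parasitic `b(t)e_z` / faded constants (the `_false_` witnesses: killed by decay resp.
  gauge resp. ancientness); pure-swirl fields `u_θ(r,t)e_θ` (exact NS for ANY solution of the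
  linear Stokes equation — potential vortex, Lamb–Oseen, diffusing Bessel modes — but
  `z`-independent ⇒ planar ⇒ constant by KNSS Thm 5.1 ⇒ 0; the potential vortex is singular,
  Lamb–Oseen is not ancient, a BACKWARD-concentrating core of size `√(−t)` would be an ancient
  solution of the 2-D heat equation concentrating forward in time, impossible); Burgers / Sullivan
  vortices (swirl sustained by strain — the only known mechanism for a standing swirl front — need
  an UNBOUNDED strain field, not Type-I); Landau solutions (singular, steady); steady,
  time-periodic or rigidly co-moving fields (sup-norm not → 0 as `t → −∞`); backward self-similar
  with bounded profile (Tsai 1998 Thm 1, `q = ∞`, tree `tsai_selfsimilar_bounded_holds`: profile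
  constant ⇒ gauge); axisymmetric backward DSS profiles (Bradshaw–Tsai open problem; none known).
* NO FINITE / SMALL MODEL: the statement quantifies over smooth fields on `ℝ³ × (−∞,0)`; no
  decidable instance, and a numerical axisymmetric ancient profile could not be certified into
  `𝒜_C`. No kit job was run (nothing certifiable to compute).
* HYPOTHESES PROBABLY REDUNDANT (information, not proved): skewness of `A` (a non-skew generator
  with a real nonzero eigenvalue forces vanishing along expanding/contracting directions by
  boundedness; a nilpotent one forces `x₁`-independence, back to the planar leaf); smoothness and
  divergence-freeness should follow from the Oseen equation + boundedness (KNSS Prop. 4.1).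

## (d) The disprover's map of the open content (for provers and the planner)

Everything reduces to the PARABOLIC FAR FIELD `ρ := |x'|/√(−t) → ∞` (in Leray variables
`y = x/√(−t)`, `s = −log(−t)`: the region `|y'| → ∞` of an ETERNAL bounded solution `W` of Leray's
system `∂_s W = ΔW − ½W − ½y·∇W − W·∇W − ∇P`), equivalently to the behaviour at the vertex time
`t ↑ 0` at points off the axis:
1. QUALITATIVE far-field decay is expected for free: recentring at points with `ρ_k → ∞` turns the
   rotation into an `e₂`-translation, and `x₂`-independent Type-I ancient limits vanish by the
   tree's PROVED `KNSS2009_typeI_rate_liouville_holds`; with compactness of `𝒜_C` (KNSS Prop 4.1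
   bounds + mild closure, as in the tree's `KNSS2009_typeI_rate_compactness`) this gives
   `UniformFarFieldSmallness` (`√(−t)|u| ≤ ε` for `ρ ≥ R₀(ε)`, uniformly over the class). Not
   formalised; no obstruction seen.
2. The RATE is the whole difficulty: `VerticalAxesDecay` is `k(ρ) := sup √(−t)|u| ≲ 1/ρ`. Two
   attempted upgrades and where each stalls: (i) entry-time Oseen bootstrap (mild identity from the
   entry time `t_e = −r²/R₀²` of `x` into `{ρ ≥ R₀}`: the caloric part is `≤ C/√(−t_e) = CR₀/r`
   EXACTLY the `1/r` law, the core's Duhamel contribution is `O(C²R₀)/r`, the far self-interaction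
   is linear in `N = sup r|u|` with coefficient `O(ε)` EXCEPT on the disc `{|y'| ≲ 2r}` over the
   long window `(t_e, t)`, where `∫_{t_e}^{t} dτ/√((t−τ)(−τ)) = log(ρ²/R₀²)` loses a logarithm —
   the same logarithm the planner fears in FarPastLedger's last step; a truncation in `ρ` closes
   the estimate only up to `ρ ≤ exp(c/ε(R₀))`); (ii) KNSS's own cut-off argument for Thm 5.3 run
   with Type-I drifts: it needs the rescaled drifts bounded near the axis over the test window,
   which holds iff the near-maximum points of `Γ` have BOUNDED parabolic radius — case A, excluded
   verbatim by the printed argument — leaving case B: `sup|Γ|` approached only along `ρ_k → ∞`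
   (hugging the vertex), where the rescaled drift bound `C/√(s_v − s)` degenerates. Both stall at
   the same place: no uniform control at the vertex time off the axis. In the energy class that
   control is CKN ε-regularity off the axis (singular set ⊂ axis); in `𝒜_C` it is missing, and
   FarPastLedger is one way to buy it.
3. What a counterexample therefore is: an eternal bounded axisymmetric Leray-variables solution
   `W` with swirl `G = Γ` bounded by `2C²` (§(e)), `|G| ≤ Cρ` near the axis, `sup|G| > 0` attained
   asymptotically as `|y'| → ∞` (LRZ §4) at log-times `s → +∞` relative to each scale, poloidal
   part with `sup ρ|W_b| = ∞`, and far field decaying in `ρ` slower than `1/ρ` (else KNSS 5.3) —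
   a standing swirl front at parabolic infinity sustained by poloidal inflow against the outward
   drift `(2/r)∂_r` and diffusion, with no energy budget. Nothing like it exists in print.

-- Targets: none yet (payload.stuck_stubs = [], no line picked).
-/

end Summit.NavierStokesRegularity.NavierStokesRegularity.Cruxes.AxisymEndLiouville.Disproof

end
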